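import Literature.AnabelianGeometry.SemiGraphs.TemperedHostEdgeEndsOfSaturatedSeq
import Literature.AnabelianGeometry.SemiGraphs.TemperedPiSystemSurj
import HarnessLib

/-!
# [SemiAnbd] Cor 3.9 (R3c) `EdgeLikeCentralizerAt` for ARBITRARY edge groups when the open edge pieces are
# UNIFORMLY OPEN IN THEIR HOSTS — an intrinsic class-free criterion at every chart (proof-only)

Mochizuki, *Semi-graphs of anabelioids*, Publ. RIMS **42** (2006), §3, Corollary 3.9, proof p. 43 l. 13
("[again by Theorem 3.7, (iii), (iv)]" — the cell's step (R3c), FACT-LIST rows F-2772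
`EdgeLikeCentralizerAt` / F-2773 `EdgeLikeCentralizer`) [cite: MochizukiSemiAnbd2006, Cor 3.9 p.43].

PROOF-ONLY (cell abc-iut, block F, seat abc-iut-f-176 gen 5; the INTRINSIC form of this seat's saturation
criterion p499292 `edgeLikeCentralizerAt_of_saturated`; no definition, no named fact).  A HOST of a
subgroup `C` of `π₁^temp(𝒢)` is a compatible edge-point sequence `T` of the Galois tower (over any base edge)
all of whose tree edges `T.edge n` are fixed by `C` — equivalently an edge-like subgroup
`L_T = T.decompHomE(Π_{e'})` containing `C` ([SemiAnbd] Rmk 2.2.1; `EdgeSeq.mem_range_decompHomE_of_fixes`).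
`C` is UNIFORMLY OPEN IN ITS HOSTS (from level `j₀`) if `L_T ∩ ker ρ_{j₀} ≤ C` for every host `T`.
* `saturatedSeq_of_uniformHosts` — uniform openness from `j₀` ⇒ saturation of every host at every level
  `n` relative to every reference level `j ≥ j₀` (the stabiliser of `T.edge n` in `Gal(𝒢_{∞,n}/𝒢)` is
  `ρ_n(L_T)`: `EdgeSeq.exists_galE_eq_proj_of_fixes`, surjectivity of `ρ_n`);
* `dist_le_four_of_fixed_pair_of_eventually_saturatedSeq` — `hbdd` with bound `4` at every level from
  saturation along the hosts (the push-down of `TemperedHostEdgeEndsOfSaturatedSeq`);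
* `centralizer_le_verticial_of_uniformHosts` — canonical chart: a compact `C ≠ 1` fixing the edges of an
  edge-point sequence and uniformly open in its hosts has `centralizer C ≤ H` for every verticial `H ⊇ C`;
* `edgeLikeCentralizerAt_of_uniformHosts` — **F-2772 `EdgeLikeCentralizerAt ℋ c` at EVERY chart of every
  graph of anabelioids satisfying the hypotheses of Cor. 3.9 in which every open edge piece `ψ₀(U)` (at the
  canonical chart) is uniformly open in its hosts** — arbitrary edge groups, arbitrary underlying graph.
Reading: by the two-point locus the conclusion forces `ψ₀(U)` to have a UNIQUE host (its anchor edge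
system); the theorem says that uniform openness in the hosts already implies uniqueness.  With abc-iut-f-172
gen 7's top-cyclic class (p493572) the bare ∀ F-2773 is reduced to graphs in which some open edge piece
has hosts `L_i` with `L_i ∩ ker ρ_j ⊄ ψ₀(U)` for every `j` (pieces sitting ever deeper in non-cyclic hosts).

Honest framing: one sufficient condition; the ∀-closures F-2773 / F-1732 are NOT claimed; nothing here
bears on [IUTchIII] Cor. 3.12; typed ≠ proved elsewhere.
-/

namespace Literature.AnabelianGeometry.SemiGraphs

namespace ProfiniteSemiGraph

open CategoryTheory Topology

universe u

variable (𝒢 : ProfiniteSemiGraph.{u}) (h37 : 𝒢.Thm37Hypotheses)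

/-- **Uniform openness in the hosts ⇒ saturation along the hosts.**  Canonical tower.  If every host `T`
of `C` (edge-point sequence with `C`-fixed tree edges) satisfies `T.decompHomE(k) ∈ C` whenever
`ρ_{j₀}(T.decompHomE(k)) = 1`, then for all `j₀ ≤ j ≤ n` every element of `Gal(𝒢_{∞,n}/𝒢)` fixing
`T.edge n` and trivial in `Gal(𝒢_{∞,j}/𝒢)` lies in `ρ_n(C)`: such an element is `ρ_n(g)` for some `g`
(surjectivity), `g` fixes `T.edge n`, so `ρ_n(g) = ρ_n(T.decompHomE(k))` for some `k ∈ Π_{e'}`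
(`EdgeSeq.exists_galE_eq_proj_of_fixes`), and `ρ_{j₀}(T.decompHomE(k)) = 1`.
[cite: MochizukiSemiAnbd2006, Rmk 2.2.1 p.24] -/
theorem saturatedSeq_of_uniformHosts (C : Subgroup (𝒢.temperedPiChart h37.toProp36Hypotheses).G) (j₀ : ℕ)
    (hU : ∀ (e' : 𝒢.graph.Edge) (T : (𝒢.galoisLevelData h37.toProp36Hypotheses).EdgeSeq h37.toProp36Hypotheses.isCountable e'),
      (∀ g ∈ C, ∀ m, ((𝒢.galoisLevelData h37.toProp36Hypotheses).treeAct h37.toProp36Hypotheses.isCountable m g).hom.edgeMap (T.edge m) = T.edge m) →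
      ∀ k : 𝒢.Ge e', (𝒢.galoisLevelData h37.toProp36Hypotheses).proj h37.toProp36Hypotheses.isCountable j₀ (T.decompHomE h37.isConnected k) = 1 →
        T.decompHomE h37.isConnected k ∈ C)
    :
    ∀ (j : ℕ), j₀ ≤ j → ∀ (n : ℕ) (hjn : j ≤ n) (e' : 𝒢.graph.Edge) (T : (𝒢.galoisLevelData h37.toProp36Hypotheses).EdgeSeq h37.toProp36Hypotheses.isCountable e'),
      (∀ g ∈ C, ∀ m, ((𝒢.galoisLevelData h37.toProp36Hypotheses).treeAct h37.toProp36Hypotheses.isCountable m g).hom.edgeMap (T.edge m) = T.edge m) →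
      ∀ q : (𝒢.galoisLevelData h37.toProp36Hypotheses).Gal h37.toProp36Hypotheses.isCountable n, (𝒢.galoisLevelData h37.toProp36Hypotheses).mapLE h37.toProp36Hypotheses.isCountable hjn q = 1 →
        ((𝒢.galoisLevelData h37.toProp36Hypotheses).galTreeAct h37.toProp36Hypotheses.isCountable n q).hom.edgeMap (T.edge n) = T.edge n →
        q ∈ C.map ((𝒢.galoisLevelData h37.toProp36Hypotheses).proj h37.toProp36Hypotheses.isCountable n) := by
  intro j hj n hjn e' T hT q hq1 hqfix
  let D := 𝒢.galoisLevelData h37.toProp36Hypotheses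
  let hc := h37.toProp36Hypotheses.isCountable
  obtain ⟨g, hg⟩ := D.proj_surjective hc n q
  have hgfix : (D.treeAct hc n g).hom.edgeMap (T.edge n) = T.edge n := by
    rw [D.treeAct_apply, hg]; exact hqfix
  obtain ⟨k, hk⟩ := T.exists_galE_eq_proj_of_fixes h37.isConnected n g hgfix
  have hkq : D.proj hc n (T.decompHomE h37.isConnected k) = q := by
    rw [T.proj_decompHomE h37.isConnected, hk, hg]
  have hk0 : D.proj hc j₀ (T.decompHomE h37.isConnected k) = 1 := by
    rw [← D.mapLE_proj hc (hj.trans hjn), hkq, ← D.mapLE_trans hc hj hjn, hq1, map_one]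
  exact ⟨_, hU e' T hT k hk0, hkq⟩

/-- **`hbdd` with bound `4` at EVERY level from saturation along the hosts above `j₀`.**
[cite: MochizukiSemiAnbd2006, Thm 3.7(iii) p.41] -/
theorem dist_le_four_of_fixed_pair_of_eventually_saturatedSeq
    (C : Subgroup (𝒢.temperedPiChart h37.toProp36Hypotheses).G) (hC : C ≠ ⊥) {e₀ : 𝒢.graph.Edge}
    (Q : (𝒢.galoisLevelData h37.toProp36Hypotheses).EdgeSeq h37.toProp36Hypotheses.isCountable e₀)
    (hQ : ∀ g ∈ C, ∀ n, ((𝒢.galoisLevelData h37.toProp36Hypotheses).treeAct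
      h37.toProp36Hypotheses.isCountable n g).hom.edgeMap (Q.edge n) = Q.edge n)
    {b₁ b₂ : 𝒢.graph.Branch} (hb12 : b₁ ≠ b₂) (hb₁e : 𝒢.graph.edgeOf b₁ = e₀)
    (hb₂e : 𝒢.graph.edgeOf b₂ = e₀) {v₁ v₂ : 𝒢.graph.Vertex} (hb₁ : 𝒢.graph.abuts b₁ = some v₁)
    (hb₂ : 𝒢.graph.abuts b₂ = some v₂)
    (x x' : ∀ n, ((𝒢.galoisLevelData h37.toProp36Hypotheses).tree n).Vertex)
    (hx : ∀ ⦃i n : ℕ⦄ (hin : i ≤ n),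
      ((𝒢.galoisLevelData h37.toProp36Hypotheses).treeTrans hin).vertexMap (x n) = x i)
    (hx' : ∀ ⦃i n : ℕ⦄ (hin : i ≤ n),
      ((𝒢.galoisLevelData h37.toProp36Hypotheses).treeTrans hin).vertexMap (x' n) = x' i)
    (hfx : ∀ g ∈ C, ∀ n, ((𝒢.galoisLevelData h37.toProp36Hypotheses).treeAct
      h37.toProp36Hypotheses.isCountable n g).hom.vertexMap (x n) = x n)
    (hfx' : ∀ g ∈ C, ∀ n, ((𝒢.galoisLevelData h37.toProp36Hypotheses).treeAct
      h37.toProp36Hypotheses.isCountable n g).hom.vertexMap (x' n) = x' n) (j₀ : ℕ)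
    (hsat : ∀ (j : ℕ), j₀ ≤ j → ∀ (n : ℕ) (hjn : j ≤ n) (e' : 𝒢.graph.Edge) (T : (𝒢.galoisLevelData h37.toProp36Hypotheses).EdgeSeq h37.toProp36Hypotheses.isCountable e'),
      (∀ g ∈ C, ∀ m, ((𝒢.galoisLevelData h37.toProp36Hypotheses).treeAct h37.toProp36Hypotheses.isCountable m g).hom.edgeMap (T.edge m) = T.edge m) →
      ∀ q : (𝒢.galoisLevelData h37.toProp36Hypotheses).Gal h37.toProp36Hypotheses.isCountable n, (𝒢.galoisLevelData h37.toProp36Hypotheses).mapLE h37.toProp36Hypotheses.isCountable hjn q = 1 →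
        ((𝒢.galoisLevelData h37.toProp36Hypotheses).galTreeAct h37.toProp36Hypotheses.isCountable n q).hom.edgeMap (T.edge n) = T.edge n →
        q ∈ C.map ((𝒢.galoisLevelData h37.toProp36Hypotheses).proj h37.toProp36Hypotheses.isCountable n))
    (j : ℕ) :
    ((𝒢.galoisLevelData h37.toProp36Hypotheses).tree j).subdivision.dist (Sum.inl (x j)) (Sum.inl (x' j)) ≤ 4 := by
  obtain ⟨δ, hδe, hδa⟩ := 𝒢.exists_branch_edge_abuts_of_fixed_of_eventually_saturatedSeq h37 C hC Q hQ hb12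
    hb₁e hb₂e hb₁ hb₂ x hx hfx j₀ hsat j
  obtain ⟨δ', hδ'e, hδ'a⟩ := 𝒢.exists_branch_edge_abuts_of_fixed_of_eventually_saturatedSeq h37 C hC Q hQ
    hb12 hb₁e hb₂e hb₁ hb₂ x' hx' hfx' j₀ hsat j
  obtain ⟨a', hends, hdist⟩ := SemiGraph.exists_ends_dist_le_four (Q.edge j) δ hδe hδa
  rcases hends δ' (x' j) hδ'e hδ'a with h | h
  · rw [h, SimpleGraph.dist_self]; exact Nat.zero_le _
  · rw [h]; exact hdist

/-- **The centraliser lies in every verticial host — arbitrary edge groups, `C` uniformly open in its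
hosts** (canonical chart).  For `𝒢` satisfying the hypotheses of Thm. 3.7, a compact `C ≠ 1` fixing the tree
edges `Q.edge n` of an edge-point sequence `Q` over a base edge `e₀` with branches `b₁ ≠ b₂` at `v₁`, `v₂`,
uniformly open in its hosts from level `j₀`, and ANY verticial `H ⊇ C`: `centralizer C ≤ H`
(`saturatedSeq_of_uniformHosts`, `dist_le_four_of_fixed_pair_of_eventually_saturatedSeq`, and
abc-iut-f-172 gen 4's `mem_verticial_of_centralizer_of_bounded_displacement`).
[cite: MochizukiSemiAnbd2006, Cor 3.9 p.43] -/
theorem centralizer_le_verticial_of_uniformHosts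
    (C : Subgroup (𝒢.temperedPiChart h37.toProp36Hypotheses).G)
    (hCc : IsCompact (C : Set (𝒢.temperedPiChart h37.toProp36Hypotheses).G)) (hC : C ≠ ⊥)
    {e₀ : 𝒢.graph.Edge}
    (Q : (𝒢.galoisLevelData h37.toProp36Hypotheses).EdgeSeq h37.toProp36Hypotheses.isCountable e₀)
    (hQ : ∀ g ∈ C, ∀ n, ((𝒢.galoisLevelData h37.toProp36Hypotheses).treeAct
      h37.toProp36Hypotheses.isCountable n g).hom.edgeMap (Q.edge n) = Q.edge n)
    {b₁ b₂ : 𝒢.graph.Branch} (hb12 : b₁ ≠ b₂) (hb₁e : 𝒢.graph.edgeOf b₁ = e₀)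
    (hb₂e : 𝒢.graph.edgeOf b₂ = e₀) {v₁ v₂ : 𝒢.graph.Vertex} (hb₁ : 𝒢.graph.abuts b₁ = some v₁)
    (hb₂ : 𝒢.graph.abuts b₂ = some v₂) (j₀ : ℕ)
    (hU : ∀ (e' : 𝒢.graph.Edge) (T : (𝒢.galoisLevelData h37.toProp36Hypotheses).EdgeSeq h37.toProp36Hypotheses.isCountable e'),
      (∀ g ∈ C, ∀ m, ((𝒢.galoisLevelData h37.toProp36Hypotheses).treeAct h37.toProp36Hypotheses.isCountable m g).hom.edgeMap (T.edge m) = T.edge m) →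
      ∀ k : 𝒢.Ge e', (𝒢.galoisLevelData h37.toProp36Hypotheses).proj h37.toProp36Hypotheses.isCountable j₀ (T.decompHomE h37.isConnected k) = 1 →
        T.decompHomE h37.isConnected k ∈ C)
    {v : 𝒢.graph.Vertex} {H : Subgroup (𝒢.temperedPiChart h37.toProp36Hypotheses).G}
    (hH : H ∈ verticialSubgroups (𝒢.temperedPiChart h37.toProp36Hypotheses) v) (hCH : C ≤ H) :
    Subgroup.centralizer (C : Set (𝒢.temperedPiChart h37.toProp36Hypotheses).G) ≤ H := by
  intro g hg
  obtain ⟨y, hyc, hyH⟩ := 𝒢.exists_fixed_system_of_mem_verticialSubgroups h37 hH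
  have hcomm : ∀ k ∈ C, k * g = g * k := fun k hk => Subgroup.mem_centralizer_iff.mp hg k hk
  have hyC : ∀ k ∈ C, ∀ j,
      ((verticialLevelData_temperedPiChart (h36 := h37.toProp36Hypotheses)).act j k).hom.vertexMap (y j) =
        y j := fun k hk j => hyH k (hCH hk) j
  have hy₁c := (verticialLevelData_temperedPiChart (h36 := h37.toProp36Hypotheses)).translate_compat' g hyc
  have hy₁C := (verticialLevelData_temperedPiChart (h36 := h37.toProp36Hypotheses)).translate_fixed' hcomm hyC
  have hsat := 𝒢.saturatedSeq_of_uniformHosts h37 C j₀ hU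
  exact 𝒢.mem_verticial_of_centralizer_of_bounded_displacement h37 C hCc hC hH hCH y hyc hyH g hg
    ⟨4, fun j => 𝒢.dist_le_four_of_fixed_pair_of_eventually_saturatedSeq h37 C hC Q hQ hb12 hb₁e hb₂e hb₁ hb₂
      y (fun j => ((verticialLevelData_temperedPiChart (h36 := h37.toProp36Hypotheses)).act j g).hom.vertexMap
        (y j)) hyc hy₁c hyC hy₁C j₀ hsat j⟩

variable {𝒢} {ℋ : ProfiniteSemiGraph.{u}}

/-- **(R3c) F-2772 `EdgeLikeCentralizerAt ℋ c` at EVERY chart, ARBITRARY edge groups, when every open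
edge piece is UNIFORMLY OPEN IN ITS HOSTS** — for a graph of anabelioids `ℋ` satisfying the hypotheses of
[SemiAnbd] Cor. 3.9 (any underlying graph) such that, at the canonical chart `c₀`, for every edge
homomorphism `ψ₀` at an edge `e` and every open `U ≤ Π_e` there is a level `j₀` with
`T.decompHomE(Π_{e'}) ∩ ker ρ_{j₀} ≤ ψ₀(U)` for every edge-point sequence `T` whose tree edges are fixed by
`ψ₀(U)`.  The open piece `ψ(U)` at the chart `c` is transported to `c₀` (`TemperedPiChart.exists_compatIso`,
`isEdgeHom_comp_of_compat`), fixes the tree edges of an edge-point sequence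
(`exists_edgeSeq_fixing_of_le_of_mem_edgeLikeSubgroups`), and `centralizer_le_verticial_of_uniformHosts`
applies. [cite: MochizukiSemiAnbd2006, Cor 3.9 p.43] -/
theorem edgeLikeCentralizerAt_of_uniformHosts (hℋ : Cor39Hypotheses ℋ)
    (hhost : ∀ (e : ℋ.graph.Edge) (ψ₀ : ℋ.Ge e →ₜ* (ℋ.temperedPiChart hℋ.thm37Hypotheses.toProp36Hypotheses).G),
      IsEdgeHom (ℋ.temperedPiChart hℋ.thm37Hypotheses.toProp36Hypotheses) e ψ₀ →
      ∀ U : Subgroup (ℋ.Ge e), IsOpen (U : Set (ℋ.Ge e)) → ∃ j₀ : ℕ,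
        ∀ (e' : ℋ.graph.Edge) (T : (ℋ.galoisLevelData hℋ.thm37Hypotheses.toProp36Hypotheses).EdgeSeq hℋ.thm37Hypotheses.toProp36Hypotheses.isCountable e'),
          (∀ g ∈ (U.map ψ₀.toMonoidHom), ∀ m, ((ℋ.galoisLevelData hℋ.thm37Hypotheses.toProp36Hypotheses).treeAct hℋ.thm37Hypotheses.toProp36Hypotheses.isCountable m g).hom.edgeMap (T.edge m) = T.edge m) →
          ∀ k : ℋ.Ge e', (ℋ.galoisLevelData hℋ.thm37Hypotheses.toProp36Hypotheses).proj hℋ.thm37Hypotheses.toProp36Hypotheses.isCountable j₀ (T.decompHomE hℋ.thm37Hypotheses.isConnected k) = 1 →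
            T.decompHomE hℋ.thm37Hypotheses.isConnected k ∈ (U.map ψ₀.toMonoidHom))
    (c : TemperedPiChart ℋ) : EdgeLikeCentralizerAt ℋ c := by
  intro e ψ hψ U hU v H hH hUH
  have h37 : ℋ.Thm37Hypotheses := hℋ.thm37Hypotheses
  obtain ⟨hCc, hC⟩ := isCompact_map_and_ne_bot_of_isEdgeHom hℋ c e ψ hψ U hU
  -- the two branches of `e` and their vertices
  obtain ⟨b₁, b₂, hb12, hb₁e, hb₂e, -⟩ := ℋ.graph.two_branches e
  obtain ⟨w₁, hw₁⟩ := Option.isSome_iff_exists.mp (hℋ.isGraph.abuts_isSome b₁)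
  obtain ⟨w₂, hw₂⟩ := Option.isSome_iff_exists.mp (hℋ.isGraph.abuts_isSome b₂)
  -- transport to the canonical chart `c₀`
  obtain ⟨φ, ψ', hψφ, hφψ, hφ, hψ'⟩ :=
    TemperedPiChart.exists_compatIso (ℋ.temperedPiChart h37.toProp36Hypotheses) c
  have hinj : Function.Injective ψ' := fun y₁ y₂ h => by rw [← hφψ y₁, ← hφψ y₂, h]
  have hmapV : ∀ {w : ℋ.graph.Vertex} {K : Subgroup c.G}, K ∈ verticialSubgroups c w →
      K.map ψ'.toMonoidHom ∈ verticialSubgroups (ℋ.temperedPiChart h37.toProp36Hypotheses) w :=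
    fun hK => (mem_verticialSubgroups_iff_map φ hφ ψ' hφψ hψ' _).mp hK
  have hL : ψ.range.map ψ'.toMonoidHom ∈
      edgeLikeSubgroups (ℋ.temperedPiChart h37.toProp36Hypotheses) (ℋ.graph.edgeOf b₁) := by
    rw [hb₁e]
    exact (mem_edgeLikeSubgroups_iff_map φ hφ ψ' hφψ hψ' _).mp ⟨ψ, hψ, rfl⟩
  -- the transported piece is the open piece of the edge homomorphism `ψ' ∘ ψ` of the canonical chart
  have hψ₀ : IsEdgeHom (ℋ.temperedPiChart h37.toProp36Hypotheses) e (ψ'.comp ψ) :=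
    isEdgeHom_comp_of_compat ψ' hψ' hψ
  have hCU : (U.map ψ.toMonoidHom).map ψ'.toMonoidHom = U.map (ψ'.comp ψ).toMonoidHom := by
    rw [Subgroup.map_map]
    rfl
  obtain ⟨j₀, hUj⟩ := hhost e (ψ'.comp ψ) hψ₀ U hU
  have hC₀c : IsCompact ((U.map (ψ'.comp ψ).toMonoidHom :
      Subgroup (ℋ.temperedPiChart h37.toProp36Hypotheses).G) :
        Set (ℋ.temperedPiChart h37.toProp36Hypotheses).G) := by
    rw [← hCU, Subgroup.coe_map]
    exact hCc.image ψ'.continuous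
  have hC₀ : U.map (ψ'.comp ψ).toMonoidHom ≠ ⊥ := fun h0 =>
    hC ((Subgroup.map_eq_bot_iff_of_injective (U.map ψ.toMonoidHom) hinj).mp (hCU.trans h0))
  have hC₀L : U.map (ψ'.comp ψ).toMonoidHom ≤ ψ.range.map ψ'.toMonoidHom := by
    rw [← hCU]; exact Subgroup.map_mono (Subgroup.map_le_range _ _)
  -- the host edge-point sequence over `e = edgeOf b₁`
  obtain ⟨Q, hQ⟩ := ℋ.exists_edgeSeq_fixing_of_le_of_mem_edgeLikeSubgroups h37 _ _ hw₁ hL hC₀L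
  intro g hg
  have hg₀ : ψ' g ∈ Subgroup.centralizer (((U.map (ψ'.comp ψ).toMonoidHom :
      Subgroup (ℋ.temperedPiChart h37.toProp36Hypotheses).G)) :
        Set (ℋ.temperedPiChart h37.toProp36Hypotheses).G) := by
    refine Subgroup.mem_centralizer_iff.mpr ?_
    rintro _ ⟨k, hk, rfl⟩
    have hkg : ψ k * g = g * ψ k := Subgroup.mem_centralizer_iff.mp hg (ψ k) ⟨k, hk, rfl⟩
    change ψ' (ψ k) * ψ' g = ψ' g * ψ' (ψ k)
    rw [← map_mul, ← map_mul, hkg]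
  have hmem : ψ' g ∈ H.map ψ'.toMonoidHom :=
    ℋ.centralizer_le_verticial_of_uniformHosts h37 _ hC₀c hC₀ Q hQ hb12 rfl (hb₂e.trans hb₁e.symm) hw₁ hw₂ j₀
      hUj (hmapV hH) (by rw [← hCU]; exact Subgroup.map_mono hUH) hg₀
  obtain ⟨h, hh, hhg⟩ := hmem
  have hhg' : h = g := hinj hhg
  exact hhg' ▸ hh

end ProfiniteSemiGraph

end Literature.AnabelianGeometry.SemiGraphs
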